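import Literature.Computability.AlgebraicComplexity.ChowSymmetric
import Literature.RingTheory.Multisymmetric.Weyl
import HarnessLib
import Mathlib.LinearAlgebra.Dual.Lemmas

/-!
# Dehomogenisation of balanced multisymmetric polynomials and Weyl's theorem:
# `𝒪(V^m // H_m)[1/π] = 𝒪(Chow_m)[1/π]`

Setting of `ChowPullback.lean` … `ChowSymmetric.lean` (`k[Mat_m] = MvPolynomial (Fin m × Fin m) k`,
`R = im(chowPullback m) = 𝒪(Chow_m)`, `R̃ = ⊕_δ symBalanced m δ = 𝒪(V^m // H_m)`). Let `i₀` be a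
row (variable index) and `π = ∏_j X_{(i₀,j)} ∈ R` the pullback of the coordinate of `X_{i₀}^m`
(`chowPullback_X_rowDegIdx`).

**Result** (`exists_pow_rowProd_mul_mem_range`, characteristic zero): for every
`y ∈ 𝒪(V^m // H_m)_δ` some `π^t · y` lies in `R`. Geometrically: over the open set `π ≠ 0` of
`Chow_m` (products of linear forms none of which lies in the hyperplane `X_{i₀}^* = 0`) the
normalisation `ψ_m : V^m // H_m → Chow_m` (Bürgisser–Hüttenhain–Ikenmeyer, Proc. AMS 145 (2017) =
arXiv:1501.05528, §3, (6) and Lemma 3) is an isomorphism — the affine-chart form of Brion's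
theorem that `ψ_m` is a closed immersion off the vertex (Landsberg, arXiv:1305.7387, Thm. 7.12).

**Proof.** Dehomogenise (`dehom`: `X_{(i₀,j)} ↦ 1`, `X_{(i,j)} ↦ u_{(i,j)}`): a balanced symmetric `y`
becomes a multisymmetric polynomial in the `m` vectors `u_j ∈ k^{m-1}`, and the pullbacks `x_d` of
the coordinates of `Sym^m` become exactly the elementary multisymmetric polynomials
(`dehom_coeff_genericProduct`: dehomogenising `∏_j (∑_i X_{(i,j)} T_i)` in `T_{i₀}` gives
`∏_j (1 + ∑_{i ≠ i₀} u_{(i,j)} T_i)`). By WEYL'S THEOREM (`Literature/RingTheory/Multisymmetric/Weyl.lean`)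
`dehom y` is a polynomial in these, i.e. `dehom y = dehom (chowPullback H)` for some `H`;
re-homogenising `H` degree by degree with powers of `π` produces `Z ∈ R`, balanced of a degree
`N ≥ δ`, with `dehom Z = dehom (π^{N-δ} y)`, and `dehom` is injective on balanced polynomials of a
fixed degree (`eq_of_dehom_eq`).

## References

* [BurgisserHuttenhainIkenmeyer2017] §3 ((6), Lemma 3, "`ψ_n` is the normalization of `Chow_n`").
* [Weyl1939] Chap. II §3, Theorem (2.3.A).
* J. M. Landsberg, arXiv:1305.7387, Thm. 7.12.
-/

noncomputable section

open MvPolynomial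

namespace Literature.Computability.AlgebraicComplexity

open Literature.RingTheory.Multisymmetric

variable {k : Type*} [Field k] (m : ℕ)

/-! ### The row product `π = ∏_j X_{(i₀,j)}` is a pullback -/

/-- The coefficient of `T_{i₀}^{|S|}` in `∏_{j ∈ S} ℓ_j` is `∏_{j ∈ S} X_{(i₀,j)}`. [folklore] -/
theorem coeff_single_prod_genericLinForm (i₀ : Fin m) (S : Finset (Fin m)) :
    coeff (Finsupp.single i₀ S.card) (∏ j ∈ S, genericLinForm (k := k) m j) =
      ∏ j ∈ S, (X (i₀, j) : MvPolynomial (Fin m × Fin m) k) := by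
  classical
  induction S using Finset.induction_on with
  | empty => simp
  | insert j₀ S hj₀ ih =>
    rw [Finset.prod_insert hj₀, Finset.prod_insert hj₀, Finset.card_insert_of_notMem hj₀, coeff_mul]
    have hmem : (Finsupp.single i₀ 1, Finsupp.single i₀ S.card) ∈
        Finset.antidiagonal (Finsupp.single i₀ (S.card + 1)) := by
      rw [Finset.mem_antidiagonal, ← Finsupp.single_add, add_comm]
    rw [Finset.sum_eq_single_of_mem _ hmem]
    · have h1 := coeff_single_genericLinForm_pow (k := k) m j₀ i₀ 1
      rw [pow_one, pow_one] at h1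
      rw [h1, ih]
    · intro p hp hpne
      rw [Finset.mem_antidiagonal] at hp
      have hShom := prod_genericLinForm_pow_isHomogeneous (k := k) m S 1
      simp only [pow_one, mul_one] at hShom
      by_cases hdeg : p.1.degree = 1
      · by_cases hα : p.1 = Finsupp.single i₀ 1
        · -- then `p.2 = single i₀ |S|`, contradiction
          exfalso
          apply hpne
          refine Prod.ext hα ?_
          have h2 : p.2 + Finsupp.single i₀ 1 = Finsupp.single i₀ S.card + Finsupp.single i₀ 1 := by
            rw [← Finsupp.single_add]
            have := hp
            rwa [hα, add_comm] at this
          exact add_right_cancel h2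
        · have hlt : p.1 i₀ < 1 := apply_lt_of_ne_single m hdeg hα
          have hcoord : p.1 i₀ + p.2 i₀ = S.card + 1 := by
            have := congrArg (fun δ : Fin m →₀ ℕ => δ i₀) hp
            simpa using this
          have hzero : coeff p.2 (∏ j ∈ S, genericLinForm (k := k) m j) = 0 :=
            hShom.coeff_eq_zero fun h => by
              have := Finsupp.le_degree i₀ p.2
              omega
          rw [hzero, mul_zero]
      · have hℓ : (genericLinForm (k := k) m j₀).IsHomogeneous 1 := genericLinForm_isHomogeneous m j₀
        rw [hℓ.coeff_eq_zero hdeg, zero_mul]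

/-- The degree index of the monomial `X_{i₀}^m`. [folklore] -/
def rowDegIdx (i₀ : Fin m) : DegIdx (Fin m) m :=
  ⟨Finsupp.single i₀ m, by rw [mem_degMonomials_iff, Finsupp.degree_single]⟩

/-- **`π = ∏_j X_{(i₀,j)}` is the pullback of the coordinate of `X_{i₀}^m`.** [folklore] -/
theorem chowPullback_X_rowDegIdx (i₀ : Fin m) :
    chowPullback m (X (rowDegIdx m i₀)) =
      ∏ j : Fin m, (X (i₀, j) : MvPolynomial (Fin m × Fin m) k) := by
  rw [chowPullback_X, rowDegIdx, genericProduct]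
  have h := coeff_single_prod_genericLinForm (k := k) m i₀ Finset.univ
  rwa [Finset.card_univ, Fintype.card_fin] at h

/-- `π ∈ 𝒪(Chow_m)`. [folklore] -/
theorem rowProd_mem_range (i₀ : Fin m) :
    (∏ j : Fin m, (X (i₀, j) : MvPolynomial (Fin m × Fin m) k)) ∈ (chowPullback (k := k) m).range :=
  ⟨X (rowDegIdx m i₀), chowPullback_X_rowDegIdx m i₀⟩

/-! ### Pullbacks of homogeneous polynomials are balanced -/

/-- Products with factors in graded pieces lie in the graded piece of the total degree.
[folklore] -/
theorem prod_mem_symBalanced {κ : Type*} (S : Finset κ) (f : κ → MvPolynomial (Fin m × Fin m) k)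
    (d : κ → ℕ) (h : ∀ i ∈ S, f i ∈ symBalanced m (d i)) :
    ∏ i ∈ S, f i ∈ symBalanced m (∑ i ∈ S, d i) := by
  classical
  induction S using Finset.induction_on with
  | empty =>
    rw [Finset.prod_empty, Finset.sum_empty]
    exact one_mem_symBalanced m
  | insert a S ha ih =>
    rw [Finset.prod_insert ha, Finset.sum_insert ha]
    exact mul_mem_symBalanced m (h a (Finset.mem_insert_self a S))
      (ih fun i hi => h i (Finset.mem_insert_of_mem hi))

/-- The pullbacks `x_d` of the coordinates lie in `𝒪(V^m // H_m)_1`. [cite: BurgisserHuttenhainIkenmeyer2017, §3 (ψ_n^* graded, degree n·k ↦ k)] -/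
theorem chowPullback_X_mem_symBalanced_one (d : DegIdx (Fin m) m) :
    chowPullback m (X d) ∈ symBalanced (k := k) m 1 := by
  rw [chowPullback_X]
  have h := coeff_genericProduct_pow_mem_symBalanced (k := k) m 1 d.1
  rwa [pow_one] at h

/-- **The pullback of a homogeneous polynomial of degree `n` on `Sym^m` is balanced symmetric of
degree `n`** (`ψ_m^*` is a homomorphism of graded algebras for the grading "degree `m·n` becomes
degree `n`"). [cite: BurgisserHuttenhainIkenmeyer2017, §3 (proof of Prop. 2: the grading of ψ_n^*)] -/
theorem chowPullback_mem_symBalanced_of_isHomogeneous {F : MvPolynomial (DegIdx (Fin m) m) k}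
    {n : ℕ} (hF : F.IsHomogeneous n) : chowPullback m F ∈ symBalanced (k := k) m n := by
  classical
  rw [as_sum F, map_sum]
  refine Submodule.sum_mem _ fun s hs => ?_
  have hdeg : s.degree = n := by
    have := hF (mem_support_iff.mp hs)
    rw [Finsupp.degree_eq_weight_one]
    exact this
  rw [← mul_one (coeff s F), ← smul_eq_mul, ← smul_monomial, map_smul]
  refine Submodule.smul_mem _ _ ?_
  rw [monomial_eq, C_1, one_mul, map_finsuppProd]
  simp only [map_pow]
  have h := prod_mem_symBalanced (k := k) m s.support (fun d => chowPullback m (X d) ^ s d)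
    (fun d => s d * 1) fun d _ => pow_mem_symBalanced m (chowPullback_X_mem_symBalanced_one m d) _
  simp only [mul_one] at h
  rw [← hdeg, Finsupp.degree_apply]
  exact h

/-! ### Dehomogenisation in the row `i₀` -/

section Dehom

variable (i₀ : Fin m)

/-- The remaining rows. [folklore] -/
abbrev RowC : Type := {i : Fin m // i ≠ i₀}

/-- **Dehomogenisation** `X_{(i₀,j)} ↦ 1`, `X_{(i,j)} ↦ u_{(i,j)}` (`i ≠ i₀`): restriction of functions
on `Mat_m` to the affine chart where every form has `i₀`-th coefficient `1`. [folklore] -/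
def dehom : MvPolynomial (Fin m × Fin m) k →ₐ[k] MvPolynomial (RowC m i₀ × Fin m) k :=
  aeval fun v => if h : v.1 = i₀ then 1 else X (⟨v.1, h⟩, v.2)

/-- `dehom` on a variable of the row `i₀`. [folklore] -/
theorem dehom_X_of_eq {v : Fin m × Fin m} (h : v.1 = i₀) : dehom (k := k) m i₀ (X v) = 1 := by
  rw [dehom, aeval_X, dif_pos h]

/-- `dehom` on a variable off the row `i₀`. [folklore] -/
theorem dehom_X_of_ne {v : Fin m × Fin m} (h : v.1 ≠ i₀) :
    dehom (k := k) m i₀ (X v) = X (⟨v.1, h⟩, v.2) := by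
  rw [dehom, aeval_X, dif_neg h]

/-- `dehom` kills `π = ∏_j X_{(i₀,j)}` to `1`. [folklore] -/
theorem dehom_rowProd : dehom (k := k) m i₀ (∏ j : Fin m, X (i₀, j)) = 1 := by
  rw [map_prod]
  exact Finset.prod_eq_one fun j _ => dehom_X_of_eq m i₀ rfl

/-- `dehom` commutes with permuting the forms. [folklore] -/
theorem dehom_rename_prodMap (τ : Equiv.Perm (Fin m)) (G : MvPolynomial (Fin m × Fin m) k) :
    dehom m i₀ (rename (Prod.map id ⇑τ) G) = rename (Prod.map id ⇑τ) (dehom m i₀ G) := by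
  have h : (dehom (k := k) m i₀).comp (rename (Prod.map id ⇑τ)) =
      (rename (Prod.map id ⇑τ)).comp (dehom (k := k) m i₀) := by
    refine MvPolynomial.algHom_ext fun v => ?_
    rw [AlgHom.comp_apply, AlgHom.comp_apply, rename_X]
    by_cases hv : v.1 = i₀
    · rw [dehom_X_of_eq m i₀ hv, dehom_X_of_eq m i₀ (by simpa using hv), map_one]
    · rw [dehom_X_of_ne m i₀ hv, dehom_X_of_ne m i₀ (by simpa using hv), rename_X]
      rfl
  exact congrArg (fun φ => φ G) h

variable {m i₀} in
/-- A form-symmetric polynomial dehomogenises to a multisymmetric one. [folklore] -/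
theorem IsFormSymm.isMultisymmetric_dehom {G : MvPolynomial (Fin m × Fin m) k} (hG : IsFormSymm m G) :
    IsMultisymmetric (RowC m i₀) m (dehom m i₀ G) := fun τ => by
  rw [← dehom_rename_prodMap, hG τ]

/-! ### Dehomogenising the generic product: the `x_d` become the elementary multisymmetric
polynomials -/

/-- Restriction of a `T`-exponent to the rows `≠ i₀`. [folklore] -/
abbrev restrictExp (α : Fin m →₀ ℕ) : RowC m i₀ →₀ ℕ :=
  α.subtypeDomain fun i => i ≠ i₀

/-- `T`-exponents of a fixed degree are determined by their restriction. [folklore] -/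
theorem eq_of_restrictExp_eq {N : ℕ} {β₁ β₂ : Fin m →₀ ℕ} (h₁ : β₁.degree = N)
    (h₂ : β₂.degree = N) (h : restrictExp m i₀ β₁ = restrictExp m i₀ β₂) : β₁ = β₂ := by
  classical
  have hne : ∀ i : Fin m, i ≠ i₀ → β₁ i = β₂ i := fun i hi => by
    have := congrArg (fun γ : RowC m i₀ →₀ ℕ => γ ⟨i, hi⟩) h
    simpa [Finsupp.subtypeDomain_apply] using this
  have hsum₁ : ∑ i, β₁ i = N := by rw [← Finsupp.degree_eq_sum]; exact h₁
  have hsum₂ : ∑ i, β₂ i = N := by rw [← Finsupp.degree_eq_sum]; exact h₂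
  rw [← Finset.add_sum_erase _ _ (Finset.mem_univ i₀)] at hsum₁ hsum₂
  have hrest : ∑ i ∈ Finset.univ.erase i₀, β₁ i = ∑ i ∈ Finset.univ.erase i₀, β₂ i :=
    Finset.sum_congr rfl fun i hi => hne i (Finset.mem_erase.mp hi).1
  ext i
  by_cases hi : i = i₀
  · subst hi
    omega
  · exact hne i hi

/-- Setting `T_{i₀} = 1` in polynomials over `k[Mat_m]`-dehomogenised coefficients. [folklore] -/
def dehomT : MvPolynomial (Fin m) (MvPolynomial (RowC m i₀ × Fin m) k) →ₐ[MvPolynomial (RowC m i₀ × Fin m) k]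
    MvPolynomial (RowC m i₀) (MvPolynomial (RowC m i₀ × Fin m) k) :=
  aeval fun i => if h : i = i₀ then 1 else X ⟨i, h⟩

/-- `dehomT` on monomials: restrict the exponent. [folklore] -/
theorem dehomT_monomial (β : Fin m →₀ ℕ) (c : MvPolynomial (RowC m i₀ × Fin m) k) :
    dehomT m i₀ (monomial β c) = monomial (restrictExp m i₀ β) c := by
  classical
  rw [dehomT, aeval_monomial, monomial_eq, MvPolynomial.algebraMap_eq]
  congr 1
  rw [Finsupp.prod_fintype _ _ (fun i => pow_zero _), Finsupp.prod_fintype _ _ (fun i => pow_zero _),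
    Fintype.prod_eq_mul_prod_subtype_ne _ i₀, dif_pos rfl, one_pow, one_mul]
  refine Finset.prod_congr rfl fun i _ => ?_
  rw [dif_neg i.2, Finsupp.subtypeDomain_apply]

/-- **Coefficients survive dehomogenisation in `T_{i₀}`**: for `H` homogeneous of degree `N` and
`|α| = N`, the coefficient of `T^{α|_{≠ i₀}}` in `H(T_{i₀} = 1)` is the coefficient of `T^α` in `H`.
[folklore] -/
theorem coeff_restrictExp_dehomT {H : MvPolynomial (Fin m) (MvPolynomial (RowC m i₀ × Fin m) k)}
    {N : ℕ} (hH : H.IsHomogeneous N) {α : Fin m →₀ ℕ} (hα : α.degree = N) :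
    coeff (restrictExp m i₀ α) (dehomT m i₀ H) = coeff α H := by
  classical
  conv_lhs => rw [as_sum H, map_sum]
  simp_rw [dehomT_monomial]
  rw [coeff_sum]
  simp_rw [coeff_monomial]
  by_cases hαs : α ∈ H.support
  · rw [Finset.sum_eq_single_of_mem α hαs]
    · rw [if_pos rfl]
    · intro β hβ hβα
      rw [if_neg]
      intro h
      have hβdeg : β.degree = N := by
        have := hH (mem_support_iff.mp hβ)
        rw [Finsupp.degree_eq_weight_one]
        exact this
      exact hβα (eq_of_restrictExp_eq m i₀ hβdeg hα h)
  · rw [notMem_support_iff.mp hαs]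
    refine Finset.sum_eq_zero fun β hβ => ?_
    rw [if_neg]
    intro h
    have hβdeg : β.degree = N := by
      have := hH (mem_support_iff.mp hβ)
      rw [Finsupp.degree_eq_weight_one]
      exact this
    exact hαs ((eq_of_restrictExp_eq m i₀ hβdeg hα h) ▸ hβ)

/-- **Dehomogenising the generic product gives the generating product of the elementary
multisymmetric polynomials**: `∏_j (T_{i₀} + ∑_{i≠i₀} u_{(i,j)} T_i)` at `T_{i₀} = 1` is
`∏_j (1 + ∑_{i≠i₀} u_{(i,j)} T_i)`. [folklore] -/
theorem dehomT_map_dehom_genericProduct :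
    dehomT m i₀ (MvPolynomial.map (dehom (k := k) m i₀).toRingHom (genericProduct (k := k) m)) =
      genElem (RowC m i₀) m := by
  classical
  rw [genericProduct, map_prod, map_prod, genElem]
  refine Finset.prod_congr rfl fun j _ => ?_
  rw [genericLinForm, map_sum, map_sum, Fintype.sum_eq_add_sum_subtype_ne _ i₀, zLin]
  congr 1
  · rw [map_mul, map_C, map_X, map_mul, MvPolynomial.algHom_C, AlgHom.toRingHom_eq_coe,
      RingHom.coe_coe, dehom_X_of_eq m i₀ rfl, map_one, one_mul, dehomT, aeval_X, dif_pos rfl]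
  · refine Finset.sum_congr rfl fun i _ => ?_
    rw [map_mul, map_C, map_X, map_mul, MvPolynomial.algHom_C, AlgHom.toRingHom_eq_coe,
      RingHom.coe_coe, dehom_X_of_ne m i₀ i.2, dehomT, aeval_X, dif_neg i.2, MvPolynomial.algebraMap_eq]

/-- **The pullbacks of the coordinates of `Sym^m` dehomogenise to the elementary multisymmetric
polynomials**: `dehom (x_α) = e_{α|_{≠ i₀}}` for `|α| = m`.
[cite: Weyl1939, Chap. II §3 (the polarized elementary symmetric functions)] -/
theorem dehom_coeff_genericProduct {α : Fin m →₀ ℕ} (hα : α.degree = m) :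
    dehom m i₀ (coeff α (genericProduct (k := k) m)) =
      elemMultisymm (RowC m i₀) m (restrictExp m i₀ α) := by
  have hhom : (MvPolynomial.map (dehom (k := k) m i₀).toRingHom (genericProduct (k := k) m)).IsHomogeneous m :=
    (genericProduct_isHomogeneous (k := k) m).map _
  rw [elemMultisymm, ← dehomT_map_dehom_genericProduct, coeff_restrictExp_dehomT m i₀ hhom hα,
    coeff_map, AlgHom.toRingHom_eq_coe, RingHom.coe_coe]

/-- Extension of a restricted exponent of degree `≤ m` to a `T`-exponent of degree `m`. [folklore] -/
def extendExp (α' : RowC m i₀ →₀ ℕ) : Fin m →₀ ℕ :=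
  α'.mapDomain Subtype.val + Finsupp.single i₀ (m - α'.degree)

/-- Restricting the extension gives back the exponent. [folklore] -/
theorem restrictExp_extendExp (α' : RowC m i₀ →₀ ℕ) :
    restrictExp m i₀ (extendExp m i₀ α') = α' := by
  classical
  ext i
  rw [Finsupp.subtypeDomain_apply, extendExp, Finsupp.add_apply,
    Finsupp.mapDomain_apply Subtype.val_injective, Finsupp.single_apply, if_neg (Ne.symm i.2),
    add_zero]

/-- The extension has degree `m` (when `|α'| ≤ m`). [folklore] -/
theorem degree_mapDomain_val (α' : RowC m i₀ →₀ ℕ) :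
    (α'.mapDomain Subtype.val : Fin m →₀ ℕ).degree = α'.degree := by
  show (Finsupp.mapDomain Subtype.val α').sum (fun _ e => e) = α'.sum (fun _ e => e)
  exact Finsupp.sum_mapDomain_index_inj Subtype.val_injective

/-- The extension has degree `m` (when `|α'| ≤ m`). [folklore] -/
theorem degree_extendExp {α' : RowC m i₀ →₀ ℕ} (h : α'.degree ≤ m) :
    (extendExp m i₀ α').degree = m := by
  rw [extendExp, map_add, Finsupp.degree_single, degree_mapDomain_val]
  omega

/-- The generating product has `T`-degree `≤ m`, so `e_{α'} = 0` for `|α'| > m`. [folklore] -/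
theorem elemMultisymm_eq_zero_of_lt {α' : RowC m i₀ →₀ ℕ} (h : m < α'.degree) :
    elemMultisymm (k := k) (RowC m i₀) m α' = 0 := by
  classical
  rw [elemMultisymm]
  refine coeff_eq_zero_of_totalDegree_lt ?_
  have hdeg : ∑ i ∈ α'.support, α' i = α'.degree := rfl
  rw [hdeg]
  refine lt_of_le_of_lt ?_ h
  rw [genElem]
  refine (totalDegree_finsetProd _ _).trans ?_
  have hle : ∀ j : Fin m, ((1 : MvPolynomial (RowC m i₀) (MvPolynomial (RowC m i₀ × Fin m) k)) +
      zLin (RowC m i₀) m j).totalDegree ≤ 1 := fun j => by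
    refine (totalDegree_add _ _).trans (max_le (by rw [totalDegree_one]; exact Nat.zero_le _) ?_)
    rw [zLin]
    refine (totalDegree_finsetSum _ _).trans (Finset.sup_le fun i _ => ?_)
    refine (totalDegree_mul _ _).trans ?_
    rw [totalDegree_C, totalDegree_X, zero_add]
  calc ∑ j : Fin m, ((1 : MvPolynomial (RowC m i₀) (MvPolynomial (RowC m i₀ × Fin m) k)) +
        zLin (RowC m i₀) m j).totalDegree
      ≤ ∑ _j : Fin m, (1 : ℕ) :=
        Finset.sum_le_sum (f := fun j => ((1 : MvPolynomial (RowC m i₀)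
          (MvPolynomial (RowC m i₀ × Fin m) k)) + zLin (RowC m i₀) m j).totalDegree)
          (g := fun _ => 1) fun j _ => hle j
    _ = m := by simp

/-- **Every elementary multisymmetric polynomial is a dehomogenised pullback** (or zero).
[cite: Weyl1939, Chap. II §3 (polarized elementary symmetric functions)] -/
theorem elemMultisymm_mem_range_dehom_comp_chowPullback (α' : RowC m i₀ →₀ ℕ) :
    elemMultisymm (k := k) (RowC m i₀) m α' ∈ ((dehom (k := k) m i₀).comp (chowPullback m)).range := by
  by_cases h : α'.degree ≤ m
  · refine ⟨X ⟨extendExp m i₀ α', (mem_degMonomials_iff).mpr (degree_extendExp m i₀ h)⟩, ?_⟩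
    change dehom m i₀ (chowPullback m (X _)) = _
    rw [chowPullback_X, dehom_coeff_genericProduct m i₀ (degree_extendExp m i₀ h),
      restrictExp_extendExp]
  · rw [elemMultisymm_eq_zero_of_lt m i₀ (not_le.mp h)]
    exact Subalgebra.zero_mem _

/-! ### `dehom` is injective on balanced polynomials of a fixed degree -/

/-- Restriction of an exponent of `k[Mat_m]` to the rows `≠ i₀`. [folklore] -/
def restrictV (s : Fin m × Fin m →₀ ℕ) : RowC m i₀ × Fin m →₀ ℕ :=
  Finsupp.equivFunOnFinite.symm fun w => s (w.1.1, w.2)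

/-- Unfolding of `restrictV`. [folklore] -/
@[simp]
theorem restrictV_apply (s : Fin m × Fin m →₀ ℕ) (w : RowC m i₀ × Fin m) :
    restrictV m i₀ s w = s (w.1.1, w.2) := by
  simp [restrictV]

/-- `dehom` on monomials: drop the row `i₀` from the exponent. [folklore] -/
theorem dehom_monomial (s : Fin m × Fin m →₀ ℕ) (c : k) :
    dehom m i₀ (monomial s c) = monomial (restrictV m i₀ s) c := by
  classical
  rw [dehom, aeval_monomial, monomial_eq, MvPolynomial.algebraMap_eq]
  congr 1
  rw [Finsupp.prod_fintype _ _ (fun v => pow_zero _), Finsupp.prod_fintype _ _ (fun w => pow_zero _),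
    Fintype.prod_prod_type, Fintype.prod_prod_type, Fintype.prod_eq_mul_prod_subtype_ne _ i₀]
  rw [Finset.prod_eq_one (fun j _ => by rw [dif_pos rfl, one_pow]), one_mul]
  refine Finset.prod_congr rfl fun i _ => Finset.prod_congr rfl fun j _ => ?_
  rw [dif_neg i.2, restrictV_apply]

/-- Exponents with prescribed column sums are determined by their restriction. [folklore] -/
theorem eq_of_restrictV_eq {N : ℕ} {s s' : Fin m × Fin m →₀ ℕ} (hs : ∀ j, ∑ i, s (i, j) = N)
    (hs' : ∀ j, ∑ i, s' (i, j) = N) (h : restrictV m i₀ s' = restrictV m i₀ s) : s' = s := by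
  classical
  have hne : ∀ (i : Fin m) (hi : i ≠ i₀) (j : Fin m), s' (i, j) = s (i, j) := fun i hi j => by
    have := congrArg (fun f : RowC m i₀ × Fin m →₀ ℕ => f (⟨i, hi⟩, j)) h
    simpa using this
  ext ⟨i, j⟩
  by_cases hi : i = i₀
  · subst hi
    have h1 := hs' j
    have h2 := hs j
    rw [Fintype.sum_eq_add_sum_subtype_ne _ i] at h1 h2
    have hrest : ∑ i' : {i' // i' ≠ i}, s' (i'.1, j) = ∑ i' : {i' // i' ≠ i}, s (i'.1, j) :=
      Finset.sum_congr rfl fun i' _ => hne i'.1 i'.2 j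
    omega
  · exact hne i hi j

/-- **Coefficients survive dehomogenisation**: for `G` balanced of degree `N` and `s` with column
sums `N`, the coefficient of the restricted exponent in `dehom G` is the coefficient of `s` in `G`.
[folklore] -/
theorem coeff_restrictV_dehom {N : ℕ} {G : MvPolynomial (Fin m × Fin m) k} (hG : IsBalanced m N G)
    {s : Fin m × Fin m →₀ ℕ} (hs : ∀ j, ∑ i, s (i, j) = N) :
    coeff (restrictV m i₀ s) (dehom m i₀ G) = coeff s G := by
  classical
  conv_lhs => rw [as_sum G, map_sum]
  simp_rw [dehom_monomial]
  rw [coeff_sum]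
  simp_rw [coeff_monomial]
  have hinj : ∀ s' ∈ G.support, restrictV m i₀ s' = restrictV m i₀ s → s' = s := fun s' hs' h =>
    eq_of_restrictV_eq m i₀ hs ((isBalanced_iff m N G).mp hG s' hs') h
  by_cases hmem : s ∈ G.support
  · rw [Finset.sum_eq_single_of_mem s hmem (fun s' hs' hne => if_neg (fun h => hne (hinj s' hs' h))),
      if_pos rfl]
  · rw [notMem_support_iff.mp hmem]
    exact Finset.sum_eq_zero fun s' hs' => if_neg fun h => hmem (hinj s' hs' h ▸ hs')

/-- **`dehom` is injective on balanced polynomials of a fixed degree.** [folklore] -/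
theorem eq_of_dehom_eq {N : ℕ} {G₁ G₂ : MvPolynomial (Fin m × Fin m) k} (h₁ : IsBalanced m N G₁)
    (h₂ : IsBalanced m N G₂) (h : dehom m i₀ G₁ = dehom m i₀ G₂) : G₁ = G₂ := by
  classical
  ext s
  by_cases hs : ∀ j, ∑ i, s (i, j) = N
  · rw [← coeff_restrictV_dehom m i₀ h₁ hs, ← coeff_restrictV_dehom m i₀ h₂ hs, h]
  · have hc₁ : coeff s G₁ = 0 := by
      by_contra hc
      exact hs ((isBalanced_iff m N G₁).mp h₁ s (mem_support_iff.mpr hc))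
    have hc₂ : coeff s G₂ = 0 := by
      by_contra hc
      exact hs ((isBalanced_iff m N G₂).mp h₂ s (mem_support_iff.mpr hc))
    rw [hc₁, hc₂]

/-! ### The theorem: `π^t · 𝒪(V^m // H_m)_δ ⊆ 𝒪(Chow_m)` -/

/-- All homogeneous components up to any bound `N ≥ deg H` sum to `H`. [folklore] -/
theorem sum_homogeneousComponent_range {σ : Type*} (H : MvPolynomial σ k) {N : ℕ}
    (hN : H.totalDegree ≤ N) :
    ∑ n ∈ Finset.range (N + 1), homogeneousComponent n H = H := by
  rw [← Finset.sum_subset (Finset.range_subset_range.mpr (Nat.succ_le_succ hN)) (fun n hn hn' => by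
      apply homogeneousComponent_eq_zero
      rw [Finset.mem_range] at hn hn'
      omega)]
  exact sum_homogeneousComponent H

/-- **Weyl's theorem for the Chow variety, affine chart `π ≠ 0`**: in characteristic zero, for every
`y ∈ 𝒪(V^m // H_m)_δ` some `π^t · y` (`π = ∏_j X_{(i₀,j)}`) lies in `𝒪(Chow_m) = im(chowPullback)`;
i.e. `𝒪(V^m // H_m)[1/π] = 𝒪(Chow_m)[1/π]` — the normalisation `ψ_m` is an isomorphism over the
chart. Proof in the module docstring (dehomogenise, Weyl, rehomogenise, injectivity).
[cite: BurgisserHuttenhainIkenmeyer2017, §3 (ψ_n is the normalization of Chow_n)]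
[cite: Weyl1939, Chap. II §3 (Theorem 2.3.A)] -/
theorem exists_pow_rowProd_mul_mem_range [CharZero k] {δ : ℕ} {y : MvPolynomial (Fin m × Fin m) k}
    (hy : y ∈ symBalanced m δ) :
    ∃ t : ℕ, (∏ j : Fin m, (X (i₀, j) : MvPolynomial (Fin m × Fin m) k)) ^ t * y ∈
      (chowPullback (k := k) m).range := by
  classical
  -- Weyl: `dehom y` is a polynomial in the dehomogenised pullbacks
  have hW : dehom m i₀ y ∈ elemSubalgebra (k := k) (RowC m i₀) m :=
    (IsFormSymm.isMultisymmetric_dehom (i₀ := i₀) hy.2).mem_adjoin_elemMultisymm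
  have hle : elemSubalgebra (k := k) (RowC m i₀) m ≤
      ((dehom (k := k) m i₀).comp (chowPullback m)).range :=
    Algebra.adjoin_le (by
      rintro _ ⟨α', rfl⟩
      exact elemMultisymm_mem_range_dehom_comp_chowPullback m i₀ α')
  obtain ⟨H, hH⟩ := (AlgHom.mem_range _).mp (hle hW)
  rw [AlgHom.comp_apply] at hH
  -- rehomogenise `H` with powers of `π`
  set N := max H.totalDegree δ with hN
  have hNH : H.totalDegree ≤ N := le_max_left _ _
  have hNδ : δ ≤ N := le_max_right _ _
  have hπ1 : (∏ j : Fin m, (X (i₀, j) : MvPolynomial (Fin m × Fin m) k)) ∈ symBalanced (k := k) m 1 := by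
    rw [← chowPullback_X_rowDegIdx]
    exact chowPullback_X_mem_symBalanced_one m _
  set Z := chowPullback m (∑ n ∈ Finset.range (N + 1),
    X (rowDegIdx m i₀) ^ (N - n) * homogeneousComponent n H) with hZ
  have hZbal : Z ∈ symBalanced (k := k) m N := by
    rw [hZ, map_sum]
    refine Submodule.sum_mem _ fun n hn => ?_
    rw [map_mul, map_pow, chowPullback_X_rowDegIdx]
    have hn' : n ≤ N := Nat.lt_succ_iff.mp (Finset.mem_range.mp hn)
    have h := mul_mem_symBalanced m (pow_mem_symBalanced m hπ1 (N - n))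
      (chowPullback_mem_symBalanced_of_isHomogeneous m (homogeneousComponent_isHomogeneous n H))
    rwa [mul_one, Nat.sub_add_cancel hn'] at h
  have hZde : dehom m i₀ Z = dehom m i₀ y := by
    rw [hZ, ← hH, map_sum, map_sum]
    conv_rhs => rw [← sum_homogeneousComponent_range H hNH, map_sum, map_sum]
    refine Finset.sum_congr rfl fun n _ => ?_
    rw [map_mul, map_pow, chowPullback_X_rowDegIdx, map_mul, map_pow, dehom_rowProd, one_pow, one_mul]
  -- the candidate `π^(N-δ) y`
  have hWbal : (∏ j : Fin m, (X (i₀, j) : MvPolynomial (Fin m × Fin m) k)) ^ (N - δ) * y ∈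
      symBalanced (k := k) m N := by
    have h := mul_mem_symBalanced m (pow_mem_symBalanced m hπ1 (N - δ)) hy
    rwa [mul_one, Nat.sub_add_cancel hNδ] at h
  have hWde : dehom m i₀ ((∏ j : Fin m, (X (i₀, j) : MvPolynomial (Fin m × Fin m) k)) ^ (N - δ) * y) =
      dehom m i₀ y := by
    rw [map_mul, map_pow, dehom_rowProd, one_pow, one_mul]
  have hEq : Z = (∏ j : Fin m, (X (i₀, j) : MvPolynomial (Fin m × Fin m) k)) ^ (N - δ) * y :=
    eq_of_dehom_eq m i₀ hZbal.1 hWbal.1 (hZde.trans hWde.symm)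
  exact ⟨N - δ, hEq ▸ ⟨_, rfl⟩⟩

end Dehom

end Literature.Computability.AlgebraicComplexity


/-!
# Brion's theorem: the Hermite–Hadamard–Howe map has finite cokernel

Setting as above: `R = im(chowPullback m) = 𝒪(Chow_m) ⊆
k[Mat_m]`, `R̃ = ⊕_δ symBalanced m δ = 𝒪(V^m // H_m) ⊇ R`, `k` of characteristic zero.

**Theorem** (`exists_symBalanced_subset_range`, BRION): there is a degree `D` such that
`𝒪(V^m // H_m)_n ⊆ 𝒪(Chow_m)` for all `n ≥ D`; equivalently the Hermite–Hadamard–Howe maps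
`h_{n,m} : Sym^n(Sym^m V) → Sym^m(Sym^n V)` are surjective for `n ≥ D` (M. Brion, Manuscripta
Math. 80 (1993) 347–371; Landsberg, arXiv:1305.7387, Thm. 7.12 / Cor. 7.13: "`ψ_n` induces a closed
immersion `(W^{×n} // Γ_n) ∖ [0] → S^n W ∖ 0`", "The Hermite–Hadamard–Howe map `h_{d,n}` is surjective
for `d` sufficiently large ... because the cokernel of `ψ_n^*` is supported at a point and thus must
vanish in large degree"). With it, the normalisation `V^n // H_n` of the Chow variety
(Bürgisser–Hüttenhain–Ikenmeyer, Proc. AMS 145 (2017), §3) and `Chow_n` itself carry the same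
highest-weight vectors in large degree, which is what BHI's Theorem 3 needs (their Prop. 1 route
through the normalisation is replaced by this finite-cokernel statement).

**Proof** (elementary, characteristic zero).
1. *Uniform chart statement* (`exists_pow_rowProd_mem_conductor`): by the chart theorem above
   (Weyl) and the finiteness of `R̃` over `R` (`ChowSymmetric.lean`), one
   power `π^{t₀}` of `π = ∏_j X_{(i₀,j)}` multiplies ALL of `R̃` into `R`: `π^{t₀}` lies in the
   CONDUCTOR `𝔠 = {c | c · R̃ ⊆ R}` (`conductor`).
2. *Spreading by `GL_m`*: `𝔠` is stable under the action of `GL_m` on `k[Mat_m]`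
   (`formsRep_mem_conductor`: the action preserves `R̃` and `R`, the latter by the equivariance of the
   pullback), and `g · π = ∏_j ℓ_j(v)` for `v` the `i₀`-th row of `g⁻¹`; every `v` with `v_{i₀} ≠ 0`
   is such a row (`exists_gl_inv_row_eq`), so `(∏_j ℓ_j(v))^{t₀} ∈ 𝔠` for these `v`.
3. *Coefficients* (`coeff_mem_of_forall_aevalPt_mem`): `(∏_j ℓ_j(v))^{t₀}` is the value at `T = v` of
   `(genericProduct m)^{t₀}`; a polynomial map with values in the subspace `𝔠` on the dense set
   `v_{i₀} ≠ 0` has all its coefficients in `𝔠` (separate by a linear functional, `MvPolynomial.funext`).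
4. *Conclusion*: by `ChowCoeffIdeal.lean` every monomial of column degrees `≥ a(t₀)` lies in the
   ideal generated by these coefficients, so by the division lemma every `y ∈ R̃_n`, `n ≥ a(t₀)`, is
   `∑ c_γ a_γ` with `c_γ ∈ 𝔠`, `a_γ ∈ R̃`, hence lies in `R`.

## References

* M. Brion, *Stable properties of plethysm: on two conjectures of Foulkes*, Manuscripta Math. 80
  (1993) 347–371.
* J. M. Landsberg, arXiv:1305.7387, Thm. 7.12, Cor. 7.13.
* [BurgisserHuttenhainIkenmeyer2017] §3 (Lemma 3, Prop. 1, Thm. 3).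
-/


open MvPolynomial
open scoped Matrix

namespace Literature.Computability.AlgebraicComplexity

variable {k : Type*} [Field k] (m : ℕ)

/-! ### The action of `GL_m` preserves `𝒪(V^m // H_m)` and `𝒪(Chow_m)` -/

/-- The action of `GL_m` on a variable is a linear form in the same column. [folklore] -/
theorem isWeightedHomogeneous_formsRep_X (g : GL (Fin m) k) (v : Fin m × Fin m) :
    IsWeightedHomogeneous (colWeight m) (formsRep m g (X v)) (colWeight m v) := by
  rcases v with ⟨i', j⟩
  rw [formsRep_X]
  refine IsWeightedHomogeneous.sum _ _ _ fun i _ => ?_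
  rw [smul_eq_C_mul]
  exact (isWeightedHomogeneous_X _ _ _).C_mul _

/-- The action of `GL_m` preserves balancedness. [folklore] -/
theorem IsBalanced.formsRep {δ : ℕ} {G : MvPolynomial (Fin m × Fin m) k} (hG : IsBalanced m δ G)
    (g : GL (Fin m) k) : IsBalanced m δ (formsRep m g G) := by
  classical
  rw [IsBalanced, as_sum G, map_sum]
  refine IsWeightedHomogeneous.sum _ _ _ fun s hs => ?_
  have hws : Finsupp.weight (colWeight m) s = fun _ => δ := hG (mem_support_iff.mp hs)
  rw [← mul_one (coeff s G), ← smul_eq_mul, ← smul_monomial, map_smul, smul_eq_C_mul]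
  refine IsWeightedHomogeneous.C_mul ?_ _
  rw [formsRep_apply, linSubst, aeval_monomial, map_one, one_mul]
  have h := IsWeightedHomogeneous.prod s.support
    (fun v => (∑ u, (((formsBlockGL m g : GL (Fin m × Fin m) k) : Matrix _ _ k) u v • X u :
      MvPolynomial (Fin m × Fin m) k)) ^ s v)
    (fun v => s v • colWeight m v) (w := colWeight m) fun v _ => by
      have hX := isWeightedHomogeneous_formsRep_X (k := k) m g v
      rw [formsRep_apply, linSubst_X] at hX
      exact hX.pow _
  rw [Finsupp.prod]
  have hsum : ∑ v ∈ s.support, s v • colWeight m v = fun _ => δ := by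
    rw [← hws, Finsupp.weight_apply, Finsupp.sum]
  rw [hsum] at h
  exact h

/-- The action of `GL_m` commutes with permuting the forms. [folklore] -/
theorem rename_prodMap_formsRep (τ : Equiv.Perm (Fin m)) (g : GL (Fin m) k)
    (G : MvPolynomial (Fin m × Fin m) k) :
    rename (Prod.map id ⇑τ) (formsRep m g G) = formsRep m g (rename (Prod.map id ⇑τ) G) := by
  have h : (rename (Prod.map id ⇑τ)).comp
      (linSubst (Fin m × Fin m) k ((formsBlockGL m g : GL (Fin m × Fin m) k) : Matrix _ _ k)) =
      (linSubst (Fin m × Fin m) k ((formsBlockGL m g : GL (Fin m × Fin m) k) : Matrix _ _ k)).comp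
        (rename (Prod.map id ⇑τ)) := by
    refine MvPolynomial.algHom_ext fun v => ?_
    rcases v with ⟨i', j⟩
    rw [AlgHom.comp_apply, AlgHom.comp_apply, rename_X, ← formsRep_apply, ← formsRep_apply,
      Prod.map_apply, id_eq, formsRep_X, formsRep_X, map_sum]
    refine Finset.sum_congr rfl fun i _ => ?_
    rw [map_smul, rename_X]
    rfl
  have := congrArg (fun φ => φ G) h
  simpa only [AlgHom.comp_apply, ← formsRep_apply] using this

/-- **`GL_m` preserves the graded pieces `𝒪(V^m // H_m)_δ`.** [cite: BurgisserHuttenhainIkenmeyer2017, §3 (the H_n-action commutes with the G-action)] -/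
theorem formsRep_mem_symBalanced {δ : ℕ} {G : MvPolynomial (Fin m × Fin m) k}
    (hG : G ∈ symBalanced m δ) (g : GL (Fin m) k) : formsRep m g G ∈ symBalanced m δ :=
  ⟨hG.1.formsRep m g, fun τ => by rw [rename_prodMap_formsRep, hG.2 τ]⟩

/-- **`GL_m` preserves `𝒪(Chow_m) = im(chowPullback)`** (equivariance of the pullback).
[cite: BurgisserHuttenhainIkenmeyer2017, §3 (φ_n is G-equivariant)] -/
theorem formsRep_mem_range [Infinite k] (g : GL (Fin m) k) {r : MvPolynomial (Fin m × Fin m) k}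
    (hr : r ∈ (chowPullback (k := k) m).range) : formsRep m g r ∈ (chowPullback (k := k) m).range := by
  obtain ⟨F, rfl⟩ := (AlgHom.mem_range _).mp hr
  exact (AlgHom.mem_range _).mpr ⟨coordSubst m g F, chowPullback_coordSubst m g F⟩

/-! ### The conductor -/

/-- **The conductor** of `R̃ = 𝒪(V^m // H_m)` into `R = 𝒪(Chow_m)`: elements `c` of `k[Mat_m]` with
`c · 𝒪(V^m // H_m)_e ⊆ 𝒪(Chow_m)` for all `e` (a `k`-subspace). [folklore] -/
def conductor : Submodule k (MvPolynomial (Fin m × Fin m) k) where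
  carrier := {c | ∀ e : ℕ, ∀ b ∈ symBalanced m e, c * b ∈ (chowPullback (k := k) m).range}
  add_mem' {a b} ha hb e x hx := by
    rw [add_mul]
    exact Subalgebra.add_mem _ (ha e x hx) (hb e x hx)
  zero_mem' e x hx := by
    rw [zero_mul]
    exact Subalgebra.zero_mem _
  smul_mem' c {a} ha e x hx := by
    rw [smul_mul_assoc]
    exact Subalgebra.smul_mem _ (ha e x hx) c

/-- Membership in the conductor, unfolded. [folklore] -/
theorem mem_conductor_iff (c : MvPolynomial (Fin m × Fin m) k) :
    c ∈ conductor (k := k) m ↔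
      ∀ e : ℕ, ∀ b ∈ symBalanced m e, c * b ∈ (chowPullback (k := k) m).range :=
  Iff.rfl

/-- **The conductor is `GL_m`-stable.** [folklore] -/
theorem formsRep_mem_conductor [Infinite k] {c : MvPolynomial (Fin m × Fin m) k}
    (hc : c ∈ conductor (k := k) m) (g : GL (Fin m) k) : formsRep m g c ∈ conductor (k := k) m := by
  intro e b hb
  have hb' : formsRep m g⁻¹ b ∈ symBalanced m e := formsRep_mem_symBalanced m hb g⁻¹
  have h := formsRep_mem_range m g (hc e _ hb')
  have hgb : formsRep m g (formsRep m g⁻¹ b) = b := by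
    rw [← Module.End.mul_apply, ← map_mul, mul_inv_cancel, map_one, Module.End.one_apply]
  rwa [formsRep_apply, map_mul, ← formsRep_apply, ← formsRep_apply, hgb] at h

/-! ### Step 1: a power of `π` lies in the conductor -/

/-- Balanced polynomials of degree `e` have total degree `≤ m e`: the graded pieces of
`𝒪(V^m // H_m)` are finite-dimensional. [folklore] -/
theorem symBalanced_le_restrictTotalDegree (e : ℕ) :
    (symBalanced (k := k) m e).toAddSubmonoid ≤
      (restrictTotalDegree (Fin m × Fin m) k (m * e)).toAddSubmonoid := by
  classical
  intro y hy
  change y ∈ restrictTotalDegree (Fin m × Fin m) k (m * e)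
  rw [mem_restrictTotalDegree, totalDegree]
  refine Finset.sup_le fun s hs => ?_
  have hcol := (isBalanced_iff m e y).mp hy.1 s hs
  have hsum : (s.sum fun _ n => n) = ∑ v : Fin m × Fin m, s v := by
    rw [Finsupp.sum_fintype _ _ (fun _ => rfl)]
  rw [hsum, Fintype.sum_prod_type, Finset.sum_comm]
  calc ∑ j : Fin m, ∑ i : Fin m, s (i, j) = ∑ _j : Fin m, e := Finset.sum_congr rfl fun j _ => hcol j
    _ = m * e := by simp
    _ ≤ m * e := le_rfl

/-- The graded pieces of `𝒪(V^m // H_m)` are finite-dimensional. [folklore] -/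
instance finite_symBalanced (e : ℕ) : Module.Finite k (symBalanced (k := k) m e) :=
  Module.Finite.of_injective
    (Submodule.inclusion (symBalanced_le_restrictTotalDegree (k := k) m e) :
      symBalanced (k := k) m e →ₗ[k] restrictTotalDegree (Fin m × Fin m) k (m * e))
    (Submodule.inclusion_injective _)

/-- Higher powers of `π` keep multiplying into `R`. [folklore] -/
theorem pow_rowProd_mul_mem_range_of_le (i₀ : Fin m) {t t' : ℕ} (h : t ≤ t')
    {y : MvPolynomial (Fin m × Fin m) k}
    (hy : (∏ j : Fin m, (X (i₀, j) : MvPolynomial (Fin m × Fin m) k)) ^ t * y ∈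
      (chowPullback (k := k) m).range) :
    (∏ j : Fin m, (X (i₀, j) : MvPolynomial (Fin m × Fin m) k)) ^ t' * y ∈
      (chowPullback (k := k) m).range := by
  obtain ⟨c, rfl⟩ := Nat.exists_eq_add_of_le h
  rw [pow_add, mul_comm (_ ^ t) (_ ^ c), mul_assoc]
  exact Subalgebra.mul_mem _ (Subalgebra.pow_mem _ (rowProd_mem_range m i₀) c) hy

/-- **Uniformly on a graded piece**: one power of `π` multiplies all of `𝒪(V^m // H_m)_e` into `R`
(the piece is finite-dimensional; take the maximum over a basis of the exponents given by
`exists_pow_rowProd_mul_mem_range`). [cite: Weyl1939, Chap. II §3 (Theorem 2.3.A)] -/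
theorem exists_pow_rowProd_mul_mem_range_uniform [CharZero k] (i₀ : Fin m) (e : ℕ) :
    ∃ t : ℕ, ∀ y ∈ symBalanced (k := k) m e,
      (∏ j : Fin m, (X (i₀, j) : MvPolynomial (Fin m × Fin m) k)) ^ t * y ∈
        (chowPullback (k := k) m).range := by
  classical
  set b := Module.finBasis k (symBalanced (k := k) m e) with hb
  choose t ht using fun i : Fin (Module.finrank k (symBalanced (k := k) m e)) =>
    exists_pow_rowProd_mul_mem_range m i₀ (b i).2
  refine ⟨Finset.univ.sup t, fun y hy => ?_⟩
  have hrepr := b.sum_repr ⟨y, hy⟩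
  have hy' : y = ∑ i, b.repr ⟨y, hy⟩ i • ((b i : symBalanced (k := k) m e) : MvPolynomial (Fin m × Fin m) k) := by
    have := congrArg (fun z : symBalanced (k := k) m e => (z : MvPolynomial (Fin m × Fin m) k)) hrepr
    simpa only [Submodule.coe_sum, Submodule.coe_smul] using this.symm
  rw [hy', Finset.mul_sum]
  refine Subalgebra.sum_mem _ fun i _ => ?_
  rw [mul_smul_comm]
  exact Subalgebra.smul_mem _ (pow_rowProd_mul_mem_range_of_le m i₀ (Finset.le_sup (Finset.mem_univ i))
    (ht i)) _

/-- **Step 1: `π^{t₀}` lies in the conductor** (`t₀ ≥ 1`): combine the uniform chart statement on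
the finitely many pieces of degree `< a` with the finiteness of `R̃` over `R`
(`exists_symBalanced_subset_span_lowProducts`). [cite: BurgisserHuttenhainIkenmeyer2017, §3 (Lemma 3)] -/
theorem exists_pow_rowProd_mem_conductor [CharZero k] (i₀ : Fin m) :
    ∃ t₀ : ℕ, 0 < t₀ ∧
      (∏ j : Fin m, (X (i₀, j) : MvPolynomial (Fin m × Fin m) k)) ^ t₀ ∈ conductor (k := k) m := by
  classical
  obtain ⟨a, ha⟩ := exists_symBalanced_subset_span_lowProducts (k := k) m
  choose t ht using fun e : ℕ => exists_pow_rowProd_mul_mem_range_uniform (k := k) m i₀ e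
  set t₀ := (Finset.range a).sup t + 1 with ht₀
  refine ⟨t₀, Nat.succ_pos _, fun n y hy => ?_⟩
  have hspan := ha n y hy
  refine Submodule.span_induction (p := fun z _ =>
    (∏ j : Fin m, (X (i₀, j) : MvPolynomial (Fin m × Fin m) k)) ^ t₀ * z ∈
      (chowPullback (k := k) m).range) ?_ ?_ ?_ ?_ hspan
  · rintro _ ⟨r, hr, e, he, b, hb, rfl⟩
    rw [mul_left_comm]
    refine Subalgebra.mul_mem _ hr ?_
    refine pow_rowProd_mul_mem_range_of_le m i₀ ?_ (ht e b hb)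
    rw [ht₀]
    exact Nat.le_succ_of_le (Finset.le_sup (Finset.mem_range.mpr he))
  · rw [mul_zero]
    exact Subalgebra.zero_mem _
  · intro x y _ _ hx hy
    rw [mul_add]
    exact Subalgebra.add_mem _ hx hy
  · intro c x _ hx
    rw [mul_smul_comm]
    exact Subalgebra.smul_mem _ hx c

/-! ### Step 2: invertible matrices with a prescribed row -/

/-- For `v` with `v_{i₀} ≠ 0` there is `g ∈ GL_m` whose inverse has `i₀`-th row `v` (the matrix
`1` with row `i₀` replaced by `v` is invertible). [folklore] -/
theorem exists_gl_inv_row_eq (i₀ : Fin m) (v : Fin m → k) (hv : v i₀ ≠ 0) :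
    ∃ g : GL (Fin m) k, ∀ i, ((g⁻¹ : GL (Fin m) k) : Matrix (Fin m) (Fin m) k) i₀ i = v i := by
  classical
  set A : Matrix (Fin m) (Fin m) k := Matrix.updateRow 1 i₀ v with hA
  set w : Fin m → k := fun i => if i = i₀ then (v i₀)⁻¹ else -(v i / v i₀) with hw
  set B : Matrix (Fin m) (Fin m) k := Matrix.updateRow 1 i₀ w with hB
  have hAi : ∀ l, A i₀ l = v l := fun l => by rw [hA, Matrix.updateRow_self]
  have hAl : ∀ l, l ≠ i₀ → ∀ j, A l j = (1 : Matrix (Fin m) (Fin m) k) l j := fun l hl j => by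
    rw [hA, Matrix.updateRow_ne hl]
  have hBi : ∀ l, B i₀ l = w l := fun l => by rw [hB, Matrix.updateRow_self]
  have hBl : ∀ l, l ≠ i₀ → ∀ j, B l j = (1 : Matrix (Fin m) (Fin m) k) l j := fun l hl j => by
    rw [hB, Matrix.updateRow_ne hl]
  have hwi : w i₀ = (v i₀)⁻¹ := by rw [hw]; exact if_pos rfl
  have hwne : ∀ j, j ≠ i₀ → w j = -(v j / v i₀) := fun j hj => by rw [hw]; exact if_neg hj
  -- a row computation shared by both products
  have hrow : ∀ (x y : Fin m → k) (j : Fin m),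
      ∑ l, x l * Matrix.updateRow (1 : Matrix (Fin m) (Fin m) k) i₀ y l j =
        x i₀ * y j + if j = i₀ then 0 else x j := by
    intro x y j
    rw [Fintype.sum_eq_add_sum_subtype_ne _ i₀, Matrix.updateRow_self]
    congr 1
    have hterm : ∀ l : {l // l ≠ i₀}, x l.1 * Matrix.updateRow (1 : Matrix (Fin m) (Fin m) k) i₀ y l.1 j =
        if l.1 = j then x j else 0 := fun l => by
      rw [Matrix.updateRow_ne l.2, Matrix.one_apply]
      by_cases hl : l.1 = j
      · rw [if_pos hl, if_pos hl, ← hl, mul_one]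
      · rw [if_neg hl, if_neg hl, mul_zero]
    rw [Finset.sum_congr rfl fun l _ => hterm l]
    by_cases hj : j = i₀
    · rw [if_pos hj]
      exact Finset.sum_eq_zero fun l _ => if_neg (fun h => l.2 (h.trans hj))
    · rw [if_neg hj, Finset.sum_eq_single (⟨j, hj⟩ : {l // l ≠ i₀})
        (fun l _ hl => if_neg (fun h => hl (Subtype.ext h))) (fun h => absurd (Finset.mem_univ _) h)]
      exact if_pos rfl
  have hAB : A * B = 1 := by
    ext i j
    rw [Matrix.mul_apply]
    by_cases hi : i = i₀
    · rw [hi]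
      simp_rw [hAi]
      rw [hB, hrow, Matrix.one_apply]
      by_cases hj : j = i₀
      · rw [if_pos hj, hj, hwi, mul_inv_cancel₀ hv, add_zero, if_pos rfl]
      · rw [if_neg hj, hwne j hj, if_neg (Ne.symm hj), mul_neg, mul_div_cancel₀ _ hv, neg_add_cancel]
    · rw [Fintype.sum_eq_single i (fun l hl => by rw [hAl i hi, Matrix.one_apply_ne' hl, zero_mul]),
        hAl i hi, Matrix.one_apply_eq, one_mul, hBl i hi]
  have hBA : B * A = 1 := by
    ext i j
    rw [Matrix.mul_apply]
    by_cases hi : i = i₀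
    · rw [hi]
      simp_rw [hBi]
      rw [hA, hrow, Matrix.one_apply, hwi]
      by_cases hj : j = i₀
      · rw [if_pos hj, hj, inv_mul_cancel₀ hv, add_zero, if_pos rfl]
      · rw [if_neg hj, hwne j hj, if_neg (Ne.symm hj), ← div_eq_inv_mul, add_neg_cancel]
    · rw [Fintype.sum_eq_single i (fun l hl => by rw [hBl i hi, Matrix.one_apply_ne' hl, zero_mul]),
        hBl i hi, Matrix.one_apply_eq, one_mul, hAl i hi]
  refine ⟨⟨B, A, hBA, hAB⟩, fun i => ?_⟩
  change A i₀ i = v i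
  exact hAi i

/-- Evaluating the auxiliary variables of the generic product at a point `v : k^m`:
`T_i ↦ v_i`. [folklore] -/
def aevalPt (v : Fin m → k) :
    MvPolynomial (Fin m) (MvPolynomial (Fin m × Fin m) k) →ₐ[MvPolynomial (Fin m × Fin m) k]
      MvPolynomial (Fin m × Fin m) k :=
  aeval fun i => C (v i)

/-- The generic product at `T = v` is the product of the linear forms `ℓ_j(v) = ∑_i v_i X_{(i,j)}`.
[folklore] -/
theorem aevalPt_genericProduct (v : Fin m → k) :
    aevalPt m v (genericProduct (k := k) m) =
      ∏ j : Fin m, ∑ i : Fin m, v i • (X (i, j) : MvPolynomial (Fin m × Fin m) k) := by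
  rw [genericProduct, map_prod]
  refine Finset.prod_congr rfl fun j _ => ?_
  rw [genericLinForm, map_sum]
  refine Finset.sum_congr rfl fun i _ => ?_
  rw [map_mul, aevalPt, aeval_C, aeval_X, Algebra.algebraMap_self, RingHom.id_apply, smul_eq_C_mul,
    mul_comm]

/-- **`g · π` is the generic product evaluated at the `i₀`-th row of `g⁻¹`.** [folklore] -/
theorem formsRep_rowProd (g : GL (Fin m) k) (i₀ : Fin m) :
    formsRep m g (∏ j : Fin m, (X (i₀, j) : MvPolynomial (Fin m × Fin m) k)) =
      aevalPt m (fun i => ((g⁻¹ : GL (Fin m) k) : Matrix (Fin m) (Fin m) k) i₀ i)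
        (genericProduct (k := k) m) := by
  rw [formsRep_apply, map_prod, aevalPt_genericProduct]
  refine Finset.prod_congr rfl fun j _ => ?_
  rw [← formsRep_apply, formsRep_X]

/-! ### Step 3: coefficients of a polynomial map with values in a subspace -/

/-- **Coefficient lemma**: if the values of `Pol(T)` (coefficients in `k[Mat_m]`) at all points
`v ∈ k^m` with `v_{i₀} ≠ 0` lie in a subspace `S`, then every `T`-coefficient of `Pol` lies in `S`
(separate a bad coefficient from `S` by a linear functional; the resulting scalar polynomial vanishes
on `v_{i₀} ≠ 0`, hence is zero over an infinite field). [folklore] -/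
theorem coeff_mem_of_forall_aevalPt_mem [Infinite k] (i₀ : Fin m)
    (S : Submodule k (MvPolynomial (Fin m × Fin m) k))
    (Pol : MvPolynomial (Fin m) (MvPolynomial (Fin m × Fin m) k))
    (h : ∀ v : Fin m → k, v i₀ ≠ 0 → aevalPt m v Pol ∈ S) (γ : Fin m →₀ ℕ) : coeff γ Pol ∈ S := by
  classical
  by_contra hγ
  obtain ⟨φ, hφ, hφS⟩ := Submodule.exists_dual_map_eq_bot_of_notMem hγ inferInstance
  have hzero : ∀ x ∈ S, φ x = 0 := fun x hx => by
    have hx' : φ x ∈ S.map φ := Submodule.mem_map_of_mem hx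
    rw [hφS] at hx'
    exact (Submodule.mem_bot k).mp hx'
  -- the scalar polynomial with coefficients `φ (coeff γ' Pol)`
  set R : MvPolynomial (Fin m) k := ∑ γ' ∈ Pol.support, monomial γ' (φ (coeff γ' Pol)) with hR
  have hcoeffR : coeff γ R = φ (coeff γ Pol) := by
    rw [hR, coeff_sum]
    simp_rw [coeff_monomial]
    by_cases hmem : γ ∈ Pol.support
    · rw [Finset.sum_eq_single_of_mem γ hmem (fun b _ hb => if_neg hb), if_pos rfl]
    · rw [Finset.sum_eq_zero (fun b hb => if_neg (fun hbγ : b = γ => hmem (hbγ ▸ hb))),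
        notMem_support_iff.mp hmem, map_zero]
  have hevalR : ∀ v : Fin m → k, eval v R = φ (aevalPt m v Pol) := by
    intro v
    have hPol : aevalPt m v Pol =
        ∑ γ' ∈ Pol.support, (γ'.prod fun i e => v i ^ e) • coeff γ' Pol := by
      conv_lhs => rw [as_sum Pol, map_sum]
      refine Finset.sum_congr rfl fun γ' _ => ?_
      rw [aevalPt, aeval_monomial, Algebra.algebraMap_self, RingHom.id_apply, smul_eq_C_mul, mul_comm]
      congr 1
      rw [map_finsuppProd]
      simp only [map_pow]
    rw [hPol]
    simp only [hR, map_sum, map_smul, eval_monomial, smul_eq_mul]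
    exact Finset.sum_congr rfl fun γ' _ => mul_comm _ _
  have hvan : ∀ v : Fin m → k, eval v (R * X i₀) = 0 := by
    intro v
    rw [map_mul, eval_X]
    by_cases hv : v i₀ = 0
    · rw [hv, mul_zero]
    · rw [hevalR, hzero _ (h v hv), zero_mul]
  have hRX : R * X i₀ = 0 := MvPolynomial.funext fun v => by rw [hvan, map_zero]
  have hR0 : R = 0 := (mul_eq_zero.mp hRX).resolve_right (X_ne_zero i₀)
  apply hφ
  rw [← hcoeffR, hR0, coeff_zero]

/-! ### Step 4: Brion's theorem -/

/-- **The coefficients of `(ℓ_0⋯ℓ_{m-1})^{t₀}` lie in the conductor**: spread `π^{t₀} ∈ 𝔠` by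
`GL_m` to `(∏_j ℓ_j(v))^{t₀}` for all `v` with `v_{i₀} ≠ 0`, then take coefficients.
[cite: BurgisserHuttenhainIkenmeyer2017, §3 (the G-equivariance of ψ_n)] -/
theorem exists_forall_coeff_genericProduct_pow_mem_conductor [CharZero k] (i₀ : Fin m) :
    ∃ t₀ : ℕ, 0 < t₀ ∧ ∀ γ : Fin m →₀ ℕ,
      coeff γ (genericProduct (k := k) m ^ t₀) ∈ conductor (k := k) m := by
  obtain ⟨t₀, ht₀, hπ⟩ := exists_pow_rowProd_mem_conductor (k := k) m i₀
  refine ⟨t₀, ht₀, coeff_mem_of_forall_aevalPt_mem m i₀ (conductor m) _ fun v hv => ?_⟩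
  obtain ⟨g, hg⟩ := exists_gl_inv_row_eq m i₀ v hv
  have hfun : (fun i => ((g⁻¹ : GL (Fin m) k) : Matrix (Fin m) (Fin m) k) i₀ i) = v := funext hg
  have heq : aevalPt m v (genericProduct (k := k) m ^ t₀) =
      formsRep m g ((∏ j : Fin m, (X (i₀, j) : MvPolynomial (Fin m × Fin m) k)) ^ t₀) := by
    rw [map_pow, formsRep_apply, map_pow, ← formsRep_apply, formsRep_rowProd, hfun]
  rw [heq]
  exact formsRep_mem_conductor m hπ g

/-- **Brion's theorem (finite cokernel of the Hermite–Hadamard–Howe map).** In characteristic zero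
there is a degree `D` such that for all `n ≥ D` every element of `𝒪(V^m // H_m)_n` — every balanced
form-symmetric polynomial of column degree `n` on `Mat_m`, i.e. `Sym^m Sym^n V^*` — lies in
`𝒪(Chow_m) = im(chowPullback)`; equivalently `h_{n,m} : Sym^n(Sym^m V) → Sym^m(Sym^n V)` is surjective
for `n ≥ D`, and the normalisation `V^m // H_m → Chow_m` of BHI §3 is an isomorphism in degrees
`≥ D` (Landsberg Thm. 7.12 / Cor. 7.13 after Brion 1993). Proof in the module docstring
(conductor, `GL_m`-spreading, coefficients, division). [cite: BurgisserHuttenhainIkenmeyer2017, §3 (Lemma 3, ψ_n the normalization; Prop. 1)] -/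
theorem exists_symBalanced_subset_range [CharZero k] (i₀ : Fin m) :
    ∃ D : ℕ, ∀ n : ℕ, D ≤ n → ∀ y ∈ symBalanced (k := k) m n, y ∈ (chowPullback (k := k) m).range := by
  classical
  obtain ⟨t₀, -, hc⟩ := exists_forall_coeff_genericProduct_pow_mem_conductor (k := k) m i₀
  refine ⟨m * (t₀ * ((m - 1) * t₀ + 1) - 1) + 1 + t₀, fun n hn y hy => ?_⟩
  -- `y` lies in the ideal generated by the coefficients of `(ℓ_0⋯ℓ_{m-1})^{t₀}`
  have hyI : y ∈ Ideal.span (Set.range fun γ : (genericProduct (k := k) m ^ t₀).support =>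
      coeff γ.1 (genericProduct (k := k) m ^ t₀)) := by
    rw [← span_range_coeff_eq_span_range_coeff_support, as_sum y]
    refine Ideal.sum_mem _ fun s hs => ?_
    refine monomial_mem_span_coeff_genericProduct_pow m t₀ s (fun j => ?_) _
    rw [(isBalanced_iff m n y).mp hy.1 s hs j]
    omega
  have hn' : n = t₀ + (n - t₀) := by omega
  rw [hn'] at hy
  obtain ⟨a, ha, hya⟩ := exists_eq_sum_mul_of_mem_span m
    (fun γ : (genericProduct (k := k) m ^ t₀).support => coeff γ.1 (genericProduct (k := k) m ^ t₀))
    (fun γ => coeff_genericProduct_pow_mem_symBalanced m t₀ γ.1) hy hyI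
  rw [hya]
  exact Subalgebra.sum_mem _ fun γ _ => hc γ.1 _ _ (ha γ)

end Literature.Computability.AlgebraicComplexity
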